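import Literature.MathematicalPhysics.QuantumFieldTheory.Balaban1983to89.B9Eq365TowerQGGQWordLadder
import Literature.MathematicalPhysics.QuantumFieldTheory.Balaban1983to89.B9Eq367TowerResolventStep

/-!
# `Balaban1983to89.B9Eq367TowerQGGQInvLadder` — T. Bałaban, *Propagators for lattice gauge theories in a background field*, Commun. Math. Phys. **99** (1985) 389–434
# [Balaban1985BackgroundPropagators] (3.65)–(3.67) p. 403 («The inverse satisfies Theorem 3.2»), Thm 3.2 (3.48) p. 398, (3.25) p. 394 (the third operator of `R(U)`), with
# [Balaban1984PropagatorsII] (2.51)–(2.55) p. 232, (2.66) p. 234: **THE TWO-BACKGROUND LADDER FOR THE NE9 CHAIN's `k`-LEVEL INVERSE THIRD OPERATOR `c_k(U) = (Q̃′_kG′_k(U)²Q̃′_k(U)†)⁻¹`,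
# LATTICE-UNIFORMLY, GIVEN ITS ROWS** — for ANY right inverses `c(U)`, `c(1)` of the chain's words `X_k(U)`, `X_k(1)` whose `𝔸`-read, realified block majorants over `towerGeom` are
# `K_c e^{−δ_c d}` (the shape leaf-03's `B9Eq349ConjugatedQGGQInvSupRowTower.local_letter_QGGQInvk` delivers through `B9Eq342MajorantReadingSeam`, with its displayed letters `κ₁, γ, C_Q`):
# `conj b (readA φ c(U)) − conj b (readA φ c(1)) ≺ K·α·e^{−δ d}` with `α_X, K, δ` BEFORE `n, η, m, U` (functions of `K_c, δ_c` and the word ladder's constants) — the word ladder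
# `B9Eq365TowerQGGQWordLadder` + the resolvent step `B9Eq367TowerResolventStep` + the finite-dimensional `XC = 1 ⟹ CX = 1`

statement-level skeleton of published theorems with citation tags; proofs where landed; nothing here is a claim about the Yang–Mills mass gap

CITATION HEADER (lean-in-tree rule).  Audit cell `pub-balaban`, sub-cell `t4`, BINDER row NE9; NE9 crux-team LEAF PROVER 01 (`b2b-balaban-t4-ne9-formalise-leaf-01`,
gen 99; bears_on: R4/N22).  Vocabulary BY NAME: this lineage's `B9Eq365TowerQGGQWordLadder.exists_hasMajorantHom_QGGQ_sub_flat` ∕ `readAHom_eq_readA`, `B9Eq367TowerResolventStep.hasMajorant_inv_sub_inv`,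
`B9Eq324PenaltyKernelForm.readA` ∕ `readA_comp` ∕ `readA_id`, `B9Eq360LaplacePrimeAkLaw.conj_one`, r06's `B9Eq352DivFormLetters.conj` ∕ `conj_mul`, `B9Eq376POneLetters.conjHom_eq_conj`, pv08's
`B6RandomWalk.HasMajorant` ∕ `B6RandomWalkHom.hasMajorantHom_iff`, Mathlib's `mul_eq_one_comm`.  Sources read through those files' verbatim quotations: [Balaban1985BackgroundPropagators]
pp. 394, 398, 403; [Balaban1984PropagatorsII] pp. 232, 234.  [folklore] COMPOSITION BY NAME; NOTHING of print's proofs is reproduced beyond what the named files prove.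

WHAT IS PROVED (sorry-free; proof lane — no `def`).
* **`exists_hasMajorant_QGGQInv_sub_flat`** — given `K_c ≥ 0`, `δ_c > 0`: `∃ α_X > 0, K ≥ 0, δ > 0` BEFORE the lattice such that on print's small-field class (plus fibre-isometric level
  transporters), ANY positivity witnesses, ANY `M, R_r, H`, ANY right inverses `c(U)` of `X_k(U)` and `c(1)` of `X_k(1)` with `conj b (readA φ c(·)) ≺ K_c e^{−δ_c d}`:
  `conj b (readA φ c(U)) − conj b (readA φ c(1)) ≺ K·α·e^{−δ d}`.
HONEST SCOPE.  Junction ∕ bookkeeping; the inverse ROWS are hypotheses (their lattice-uniform inhabitant is leaf-03's Combes–Thomas road with DISPLAYED letters `κ₁, γ, C_Q` — O-NE9-1 walls);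
constants crude (NOT print's); NOT `R_k`, NOT the bond `G_k`; NE9 NOT PRINTED ∕ NOT PROVED; spine PROVED 0∕9; rung (B)+1 finite T⁴ — NOT infinite volume, NOT mass gap, NOT BetaPertH, NOT
Clay.  HONEST DEPENDENCY: continuum YM on T⁴ ⇐ BetaPertH ∧ nine spine estimates (0/9 proved); BetaPertH ⇐ (D1) ∧ (D4) ∧ CAP+tail; G-an2-4 gates asym, D1 and NE2/3/4.  NEW file; nothing
modified.  Net new unproved facts: 0.
-/

noncomputable section

open scoped BigOperators InnerProductSpace

namespace Literature.MathematicalPhysics.QuantumFieldTheory.Balaban1983to89.B9Eq367TowerQGGQInvLadder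

open B4Sect5Torus (TSite)
open B7Prop1Explicit (U1)
open B9SectCLatticeCarrier (Bond shift)
open B9Eq311L2Pairing (WL2)
open B11Eq103H1Complex (SiteL2K)
open B9Eq310HessianOperator (adTransportW)
open B9Eq315QTower (towerP UlevOf)
open B9Eq326OperatorTower (QprimeTowerW)
open B9Eq324DeltaPrimeATower (laplacePrimeAk GpOfUk)
open B6RandomWalk (HasMajorant hasMajorant_mono c1_nonneg)
open B6RandomWalkHom (hasMajorantHom_iff)
open B9Thm34Ext (toB6)
open B9Eq352DivFormLetters (conj)
open B9Eq376POneLetters (conjHom conjHom_eq_conj)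
open B9Eq324PenaltyKernelForm (readA readA_comp readA_id)
open B9Eq360LaplacePrimeAkLaw (conj_one)
open B9Eq341TowerBlockGeometry (towerGeom)
open B9Eq319QprimeTowerHomMajorants (readAHom)
open B9Eq365TowerQGGQWordLadder (exists_hasMajorantHom_QGGQ_sub_flat readAHom_eq_readA)
open B9Eq367TowerResolventStep (hasMajorant_inv_sub_inv)

variable {d : ℕ} (L : ℕ) [NeZero L] {𝔸 : Type*} [NormedRing 𝔸] [NormedAlgebra ℂ 𝔸] [CompleteSpace 𝔸] [NormOneClass 𝔸] [StarRing 𝔸] [FiniteDimensional ℂ 𝔸]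
  {W : Type*} [NormedAddCommGroup W] [InnerProductSpace ℂ W] [FiniteDimensional ℂ W] (φ : W ≃ₗ[ℂ] 𝔸) {a' Mφ Mφ' : ℝ}
  (hMφ : 0 ≤ Mφ) (hMφ' : 0 ≤ Mφ') (hφn : ∀ w, ‖φ w‖ ≤ Mφ * ‖w‖) (hφn' : ∀ X, ‖φ.symm X‖ ≤ Mφ' * ‖X‖) (ha' : 0 < a')
  {r : ℝ} (hr0 : 0 ≤ r) (hr1 : r < 1)
  (τ : 𝔸 →ₗ[ℂ] ℂ) (hτ₂ : ∀ X Y : 𝔸, τ (X * Y) = τ (Y * X)) (hφτ : ∀ X Y : 𝔸, ⟪φ.symm X, φ.symm Y⟫_ℂ = τ (star X * Y))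
  {ι : Type} [Fintype ι] [DecidableEq ι] (b : Module.Basis ι ℝ 𝔸) {M₂ : ℝ} (hM₂ : 0 ≤ M₂) (hrepr : ∀ (v : 𝔸) (i : ι), |b.repr v i| ≤ M₂ * ‖v‖)

include hMφ hMφ' hφn hφn' ha' hr0 hr1 hτ₂ hφτ hM₂ hrepr in
/-- **THE TWO-BACKGROUND LADDER FOR THE INVERSE THIRD OPERATOR, GIVEN ITS ROWS** (see the module docstring).
[cite: Balaban1985BackgroundPropagators, (3.65)–(3.67) p.403, Thm 3.2 (3.48) p.398, (3.25) p.394; Balaban1984PropagatorsII, (2.51)–(2.55) p.232, (2.66) p.234] -/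
theorem exists_hasMajorant_QGGQInv_sub_flat (hd : 1 ≤ d) (hL3 : 3 ≤ L) {Kc δc : ℝ} (hKc : 0 ≤ Kc) (hδc : 0 < δc) :
    ∃ αX K δ : ℝ, 0 < αX ∧ 0 ≤ K ∧ 0 < δ ∧
      ∀ (n : ℕ) (η : ℝ), η * (L : ℝ) ^ (n + 1) = 1 →
      ∀ (c₀ c₁ : ℝ) [Fact (0 < c₀)] [Fact (0 < c₁)], c₀ * ((L : ℝ) ^ (n + 1)) ^ d = c₁ →
      ∀ (m : Fin d → ℕ) [∀ i, NeZero (m i)] (U : Bond d (towerP L m (n + 1)) → 𝔸ˣ) (α : ℝ), 0 ≤ α → α ≤ αX →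
        (∀ bd, U bd ∈ U1 𝔸) → (∀ bd, ‖(U bd : 𝔸) - 1‖ ≤ α * η) →
        (∀ (x : TSite d (towerP L m (n + 1))) (μ ν : Fin d), ‖(U (shift ν x, μ) : 𝔸) - (U (x, μ) : 𝔸)‖ ≤ α * η ^ 2) →
      ∀ (εU : ℕ → ℝ), (∀ j, 0 ≤ εU j) → (∀ j, εU j ≤ 1) → (∀ j < n + 1, εU j ≤ α * r ^ j) →
        (∀ (j : ℕ) (bd : Bond d (towerP L m (j + 1))), ‖(UlevOf L m (n + 1) U j bd : 𝔸) - 1‖ ≤ εU j) →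
        (∀ (j : ℕ) (bd : Bond d (towerP L m (j + 1))), UlevOf L m (n + 1) U j bd ∈ U1 𝔸) →
        (∀ (j : ℕ) (bd : Bond d (towerP L m (j + 1))) (w : W), ‖adTransportW φ (UlevOf L m (n + 1) U j) bd w‖ ≤ ‖w‖) →
      ∀ (hposU : ∀ x : SiteL2K ℂ d (towerP L m (n + 1)) c₀ W, x ≠ 0 → 0 < RCLike.re ⟪x, laplacePrimeAk L m n φ η U a' (c₁ := c₁) x⟫_ℂ)
        (hpos₁ : ∀ x : SiteL2K ℂ d (towerP L m (n + 1)) c₀ W, x ≠ 0 →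
          0 < RCLike.re ⟪x, laplacePrimeAk L m n φ η (fun _ : Bond d (towerP L m (n + 1)) => (1 : 𝔸ˣ)) a' (c₁ := c₁) x⟫_ℂ)
        (M Rr : ℝ) (H : Prop) (cU c1 : SiteL2K ℂ d m c₁ W →ₗ[ℂ] SiteL2K ℂ d m c₁ W),
        (((WL2.linearEquiv ℂ ℂ (fun _ : TSite d m => c₁)).symm.toLinearMap ∘ₗ QprimeTowerW L m n φ U (c₀ := c₀)) ∘ₗ
              (GpOfUk L m n φ η U a' (c₁ := c₁) hposU ∘ₗ GpOfUk L m n φ η U a' (c₁ := c₁) hposU) ∘ₗ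
                LinearMap.adjoint ((WL2.linearEquiv ℂ ℂ (fun _ : TSite d m => c₁)).symm.toLinearMap ∘ₗ QprimeTowerW L m n φ U (c₀ := c₀))) ∘ₗ cU = LinearMap.id →
        (((WL2.linearEquiv ℂ ℂ (fun _ : TSite d m => c₁)).symm.toLinearMap ∘ₗ
                QprimeTowerW L m n φ (fun _ : Bond d (towerP L m (n + 1)) => (1 : 𝔸ˣ)) (c₀ := c₀)) ∘ₗ
              (GpOfUk L m n φ η (fun _ : Bond d (towerP L m (n + 1)) => (1 : 𝔸ˣ)) a' (c₁ := c₁) hpos₁ ∘ₗ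
                  GpOfUk L m n φ η (fun _ : Bond d (towerP L m (n + 1)) => (1 : 𝔸ˣ)) a' (c₁ := c₁) hpos₁) ∘ₗ
                LinearMap.adjoint ((WL2.linearEquiv ℂ ℂ (fun _ : TSite d m => c₁)).symm.toLinearMap ∘ₗ
                  QprimeTowerW L m n φ (fun _ : Bond d (towerP L m (n + 1)) => (1 : 𝔸ˣ)) (c₀ := c₀))) ∘ₗ c1 = LinearMap.id →
        HasMajorant (g := toB6 (towerGeom L m n η M) Rr H) (fun q : TSite d m × ι => q.1) (conj b (readA φ cU))
          (fun a a' => Kc * Real.exp (-(δc * (towerGeom L m n η M).dist a a'))) →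
        HasMajorant (g := toB6 (towerGeom L m n η M) Rr H) (fun q : TSite d m × ι => q.1) (conj b (readA φ c1))
          (fun a a' => Kc * Real.exp (-(δc * (towerGeom L m n η M).dist a a'))) →
      HasMajorant (g := toB6 (towerGeom L m n η M) Rr H) (fun q : TSite d m × ι => q.1) (conj b (readA φ cU) - conj b (readA φ c1))
        (fun a a' => K * α * Real.exp (-(δ * (towerGeom L m n η M).dist a a'))) := by
  obtain ⟨αX, KX, δX, hαX, hKX, hδX, HX⟩ := exists_hasMajorantHom_QGGQ_sub_flat L φ hMφ hMφ' hφn hφn' ha' hr0 hr1 τ hτ₂ hφτ b hM₂ hrepr hd hL3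
  have hc1h : 0 ≤ B6.c1 d (min δc δX) (1 / 2) := c1_nonneg d _ _
  refine ⟨αX, Kc * B6.c1 d (min δc δX) (1 / 2) * (KX * B6.c1 d (min δc δX) (1 / 2) * Kc), min δc δX / 2, hαX, by positivity,
    by have := lt_min hδc hδX; linarith, ?_⟩
  intro n η hη c₀ c₁ _ _ hc m _ U α hα0 hαle hU1 hUs hUw εU hε0 hε1 hεr hlev hlev1 hRlev hposU hpos₁ M Rr H cU c1 hXcU hXc1 hcU hc1
  have hW := HX n η hη c₀ c₁ hc m U α hα0 hαle hU1 hUs hUw εU hε0 hε1 hεr hlev hlev1 hRlev hposU hpos₁ M Rr H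
  rw [readAHom_eq_readA, readAHom_eq_readA, conjHom_eq_conj, conjHom_eq_conj, hasMajorantHom_iff] at hW
  -- the realified inverse relations (finite dimension: a right inverse is a left inverse)
  have hXU1 : (((WL2.linearEquiv ℂ ℂ (fun _ : TSite d m => c₁)).symm.toLinearMap ∘ₗ QprimeTowerW L m n φ U (c₀ := c₀)) ∘ₗ
              (GpOfUk L m n φ η U a' (c₁ := c₁) hposU ∘ₗ GpOfUk L m n φ η U a' (c₁ := c₁) hposU) ∘ₗ
                LinearMap.adjoint ((WL2.linearEquiv ℂ ℂ (fun _ : TSite d m => c₁)).symm.toLinearMap ∘ₗ QprimeTowerW L m n φ U (c₀ := c₀))) * cU = 1 := by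
    rw [Module.End.mul_eq_comp, Module.End.one_eq_id]; exact hXcU
  have hcUX := mul_eq_one_comm.1 hXU1
  have hinvU : conj b (readA φ cU) * conj b (readA φ (((WL2.linearEquiv ℂ ℂ (fun _ : TSite d m => c₁)).symm.toLinearMap ∘ₗ QprimeTowerW L m n φ U (c₀ := c₀)) ∘ₗ
              (GpOfUk L m n φ η U a' (c₁ := c₁) hposU ∘ₗ GpOfUk L m n φ η U a' (c₁ := c₁) hposU) ∘ₗ
                LinearMap.adjoint ((WL2.linearEquiv ℂ ℂ (fun _ : TSite d m => c₁)).symm.toLinearMap ∘ₗ QprimeTowerW L m n φ U (c₀ := c₀)))) = 1 := by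
    rw [← B9Eq352DivFormLetters.conj_mul, ← readA_comp, ← Module.End.mul_eq_comp, hcUX, Module.End.one_eq_id, readA_id, conj_one]
  have hinv1 : conj b (readA φ (((WL2.linearEquiv ℂ ℂ (fun _ : TSite d m => c₁)).symm.toLinearMap ∘ₗ
                QprimeTowerW L m n φ (fun _ : Bond d (towerP L m (n + 1)) => (1 : 𝔸ˣ)) (c₀ := c₀)) ∘ₗ
              (GpOfUk L m n φ η (fun _ : Bond d (towerP L m (n + 1)) => (1 : 𝔸ˣ)) a' (c₁ := c₁) hpos₁ ∘ₗ
                  GpOfUk L m n φ η (fun _ : Bond d (towerP L m (n + 1)) => (1 : 𝔸ˣ)) a' (c₁ := c₁) hpos₁) ∘ₗ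
                LinearMap.adjoint ((WL2.linearEquiv ℂ ℂ (fun _ : TSite d m => c₁)).symm.toLinearMap ∘ₗ
                  QprimeTowerW L m n φ (fun _ : Bond d (towerP L m (n + 1)) => (1 : 𝔸ˣ)) (c₀ := c₀)))) * conj b (readA φ c1) = 1 := by
    rw [← B9Eq352DivFormLetters.conj_mul, ← readA_comp, hXc1, readA_id, conj_one]
  refine hasMajorant_mono _ (hasMajorant_inv_sub_inv L m n η M Rr H (fun q : TSite d m × ι => q.1) hKc hKX hα0 hδc hδX hinvU hinv1 hcU hc1 hW)
    fun a a'' => le_of_eq ?_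
  ring
  
end Literature.MathematicalPhysics.QuantumFieldTheory.Balaban1983to89.B9Eq367TowerQGGQInvLadder

end
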